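import Summits.MatrixMultiplication.OmegaCensus.STPPSmallPatternT1K9OrderLaw

/-!
# ω-census, small pattern `(2,1,1)⁹`: the `T1` order law LOWERED to `57` — every finite abelian group of order `≥ 57` hosts `(2,1,1)⁹`

Cell `pub-omega`, ω construction census, seat pub-omega ENG2 (gen 39), 2026-08-30.  HONEST FRAMING (verbatim): lottery ticket; floor = certified
bounds/negative ranges.  Census STRUCTURE bookkeeping (row B5 / conjecture C10 column `T1` at `k = 9`); nothing here bears on `ω`.

The law of record `exists_isSTPP_211pow9_of_card_ge_58` (`STPPSmallPatternT1K9OrderLaw`) covers every finite abelian group of order `≥ 58`.  Night 34's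
reserve job (kit GO #176 j337414 'eng2-capwalk3-arm3', engine γ) found `(2,1,1)⁹ ⊆ ℤ/57` (`exists_isSTPP_211pow9_zmod57`, `STPPSmallPatternT1K9LowHosts`
Appendix 2).  Since `57 = 3 · 19` is squarefree, `ℤ/57` is the only abelian group of order `57`; formally we avoid the classification: by Cauchy's theorem a
group of order `57` has elements of additive order `3` and `19`, whose sum (the group is abelian) has order `57`, and the transport lemma
`exists_isSTPP_211pow9_of_addOrderOf_ge57` applies.  Hence the law drops to `57` (night lead g44's remark, 2026-08-30T03:37Z).  `ℤ/56` is open (blank at the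
job's budget, no claim), so `57` is NOT claimed sharp.
References: H. Cohn, R. Kleinberg, B. Szegedy, C. Umans, FOCS 2005 (arXiv:math/0511460), Def. 5.1.
-/

open Literature.Computability.AlgebraicComplexity Finset

namespace Summit.MatrixMultiplication.OmegaCensus

/-- A finite additive commutative group of order exactly `57` has an element of additive order `57` (Cauchy at `3` and `19`, then the order of a sum of
commuting elements of coprime orders). [folklore] -/
theorem exists_addOrderOf_eq_57_of_card_eq_57 {G : Type*} [AddCommGroup G] [Finite G] (hG : Nat.card G = 57) :
    ∃ g : G, addOrderOf g = 57 := by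
  haveI : Fact (Nat.Prime 3) := ⟨by norm_num⟩
  haveI : Fact (Nat.Prime 19) := ⟨by norm_num⟩
  obtain ⟨a, ha⟩ := exists_prime_addOrderOf_dvd_card' (G := G) 3 (by rw [hG]; norm_num)
  obtain ⟨b, hb⟩ := exists_prime_addOrderOf_dvd_card' (G := G) 19 (by rw [hG]; norm_num)
  refine ⟨a + b, ?_⟩
  rw [(AddCommute.all a b).addOrderOf_add_eq_mul_addOrderOf_of_coprime (by rw [ha, hb]; norm_num), ha, hb]

/-- **THE `k = 9` LAW AT `57`: every finite abelian group of order `≥ 57` admits an STPP family of size pattern `(2,1,1)⁹`** (CKSU Def. 5.1, tree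
`IsSTPP`).  Order `≥ 58`: the law of record `exists_isSTPP_211pow9_of_card_ge_58`; order `= 57`: an element of order `57` exists
(`exists_addOrderOf_eq_57_of_card_eq_57`) and `exists_isSTPP_211pow9_of_addOrderOf_ge57` transports the `ℤ/57` witness of kit GO #176.  No `ω` bound
follows; `57` is not claimed sharp (`ℤ/56` open). [cite: CohnKleinbergSzegedyUmans2005, Def. 5.1] -/
theorem exists_isSTPP_211pow9_of_card_ge_57 {G : Type*} [AddCommGroup G] [Finite G] (hG : 57 ≤ Nat.card G) :
    ∃ A B C : Fin 9 → Finset G, IsSTPP A B C ∧ ∀ i, (A i).card = 2 ∧ (B i).card = 1 ∧ (C i).card = 1 := by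
  by_cases h : 58 ≤ Nat.card G
  · exact exists_isSTPP_211pow9_of_card_ge_58 h
  · obtain ⟨g, hg⟩ := exists_addOrderOf_eq_57_of_card_eq_57 (G := G) (by omega)
    exact exists_isSTPP_211pow9_of_addOrderOf_ge57 g (by omega)

/-- `Nat.card`-monotone form for the census tables: `57 ≤ n ≤ Nat.card G` ⇒ host. [cite: CohnKleinbergSzegedyUmans2005, Def. 5.1] -/
theorem exists_isSTPP_211pow9_of_le_card57 {G : Type*} [AddCommGroup G] [Finite G] {n : ℕ} (hn : 57 ≤ n) (hG : n ≤ Nat.card G) :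
    ∃ A B C : Fin 9 → Finset G, IsSTPP A B C ∧ ∀ i, (A i).card = 2 ∧ (B i).card = 1 ∧ (C i).card = 1 :=
  exists_isSTPP_211pow9_of_card_ge_57 (le_trans hn hG)

end Summit.MatrixMultiplication.OmegaCensus
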